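import Mathlib
import HarnessLib

/-!
# The truncated logarithm at `z = −2`: a finite form of `log₂(−1) = 0`

For `LOG_M(z) = Σ_{1 ≤ j ≤ M} (−1)^{j+1} zʲ/j ∈ ℚ[z]` we prove (`padicNorm_logTrunc_neg_two_le`)

  `|LOG_M(−2)|₂ ≤ 2^{log₂ M − M}`,

i.e. the `2`-adic limit `lim_M LOG_M(−2) = log₂(1 + (−2)) = log₂(−1) = 0` with an explicit rate, by pure
polynomial algebra: with `Y = 2X + X²` (`1 + Y = (1+X)²`, `Y(−2) = 0`) the comparison polynomial
`H_M = LOG_M∘Y − 2·LOG_M` satisfies `(1+X)·H_M′ = 2((−X)^M − (−Y)^M)`, hence has no terms in degrees `≤ M`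
(`coeff_logCompDiff_eq_zero`); evaluating at `−2` gives `−2·LOG_M(−2) = H_M(−2) = Σ_{k>M} h_k (−2)^k` with
`|h_k|₂ ≤ 2^{log₂ M}` (denominators `j ≤ M`).  Used by `SoloBlindTwistForcing` (torsion forcing, Lemma F′).
Prose: run/shared/lean/ideation/Schanuel/solo-blind/paper/twist.md §1 (iii).  [this work]
-/

noncomputable section

open Finset

namespace Summit.Schanuel.Schanuel.Theorems

/-- The truncated logarithm `LOG_M(z) = Σ_{1 ≤ j ≤ M} (−1)^{j+1} zʲ/j` as a polynomial. [this work] -/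
def logTrunc (M : ℕ) : Polynomial ℚ :=
  ∑ j ∈ Finset.range (M + 1), Polynomial.C (ite (j = 0) (0 : ℚ) ((-1) ^ (j + 1) / (j : ℚ))) * Polynomial.X ^ j

/-- `d/dX LOG_M = Σ_{i<M} (−X)^i`. [this work] -/
theorem derivative_logTrunc (M : ℕ) :
    Polynomial.derivative (logTrunc M) = ∑ i ∈ Finset.range M, (-Polynomial.X : Polynomial ℚ) ^ i := by
  rw [logTrunc, Polynomial.derivative_sum, Finset.sum_range_succ']
  simp only [Polynomial.derivative_C_mul_X_pow, if_true, zero_mul, map_zero, pow_zero,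
    add_zero]
  refine Finset.sum_congr rfl fun i _ => ?_
  rw [if_neg (Nat.succ_ne_zero i), Nat.add_sub_cancel]
  have hi : ((i + 1 : ℕ) : ℚ) ≠ 0 := by positivity
  have hsc : ((-1 : ℚ) ^ (i + 1 + 1) / ((i + 1 : ℕ) : ℚ) * ((i + 1 : ℕ) : ℚ)) = (-1) ^ i := by
    rw [div_mul_cancel₀ _ hi, pow_succ, pow_succ]; ring
  rw [hsc, map_pow, map_neg, map_one, neg_pow, one_pow, mul_one]
  exact (neg_pow (Polynomial.X : Polynomial ℚ) i).symm

/-- `(1+X)·Σ_{i<M}(−X)^i = 1 − (−X)^M`. [folklore] -/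
theorem one_add_X_mul_geom_neg (M : ℕ) :
    (1 + Polynomial.X : Polynomial ℚ) * ∑ i ∈ Finset.range M, (-Polynomial.X : Polynomial ℚ) ^ i
      = 1 - (-Polynomial.X) ^ M := by
  have h := geom_sum_mul_neg (-Polynomial.X : Polynomial ℚ) M
  -- h : (∑ i ∈ range M, (-X)^i) * (1 - -X) = 1 - (-X)^M
  rw [sub_neg_eq_add] at h
  rw [mul_comm]
  exact h

/-- `Y := (1+X)² − 1 = 2X + X²` (so that `1 + Y = (1+X)²` and `Y(−2) = 0`). [this work] -/
def twoXaddXsq : Polynomial ℚ := 2 * Polynomial.X + Polynomial.X ^ 2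

/-- `1 + Y = (1+X)²`. [this work] -/
theorem one_add_twoXaddXsq : (1 + twoXaddXsq) = (1 + Polynomial.X) ^ 2 := by
  rw [twoXaddXsq]; ring

/-- `Y′ = 2(1+X)`. [this work] -/
theorem derivative_twoXaddXsq : Polynomial.derivative twoXaddXsq = 2 * (1 + Polynomial.X) := by
  rw [twoXaddXsq, Polynomial.derivative_add, Polynomial.derivative_mul, Polynomial.derivative_X_pow]
  simp [Polynomial.C_ofNat]; ring

/-- `Y(−2) = 0`. [this work] -/
theorem eval_neg_two_twoXaddXsq : twoXaddXsq.eval (-2) = 0 := by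
  rw [twoXaddXsq]; norm_num

/-- `(1+X)·LOG_M′ = 1 − (−X)^M`. [this work] -/
theorem one_add_X_mul_derivative_logTrunc (M : ℕ) :
    (1 + Polynomial.X) * Polynomial.derivative (logTrunc M) = 1 - (-Polynomial.X) ^ M := by
  rw [derivative_logTrunc, one_add_X_mul_geom_neg]

/-- `(1+X)·(LOG_M ∘ Y)′ = 2·(1 − (−Y)^M)`: the truncated form of `d/dX log((1+X)²) = 2/(1+X)`. [this work] -/
theorem one_add_X_mul_derivative_logTrunc_comp (M : ℕ) :
    (1 + Polynomial.X) * Polynomial.derivative ((logTrunc M).comp twoXaddXsq)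
      = 2 * (1 - (-twoXaddXsq) ^ M) := by
  have hcomp : (1 + twoXaddXsq) * (Polynomial.derivative (logTrunc M)).comp twoXaddXsq
      = 1 - (-twoXaddXsq) ^ M := by
    have h := congrArg (fun q : Polynomial ℚ => q.comp twoXaddXsq)
      (one_add_X_mul_derivative_logTrunc M)
    simp only [Polynomial.mul_comp, Polynomial.add_comp, Polynomial.one_comp, Polynomial.X_comp,
      Polynomial.sub_comp, Polynomial.pow_comp, Polynomial.neg_comp] at h
    exact h
  rw [Polynomial.derivative_comp, derivative_twoXaddXsq, one_add_twoXaddXsq] at *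
  calc (1 + Polynomial.X) * (2 * (1 + Polynomial.X) *
        (Polynomial.derivative (logTrunc M)).comp twoXaddXsq)
      = 2 * ((1 + Polynomial.X) ^ 2 * (Polynomial.derivative (logTrunc M)).comp twoXaddXsq) := by
        ring
    _ = 2 * (1 - (-twoXaddXsq) ^ M) := by rw [hcomp]

/-- The comparison polynomial `H_M := LOG_M ∘ Y − 2·LOG_M`. [this work] -/
def logCompDiff (M : ℕ) : Polynomial ℚ := (logTrunc M).comp twoXaddXsq - Polynomial.C 2 * logTrunc M

/-- `(1+X)·H_M′ = 2·((−X)^M − (−Y)^M)`. [this work] -/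
theorem one_add_X_mul_derivative_logCompDiff (M : ℕ) :
    (1 + Polynomial.X) * Polynomial.derivative (logCompDiff M)
      = Polynomial.C 2 * ((-Polynomial.X) ^ M - (-twoXaddXsq) ^ M) := by
  rw [logCompDiff, Polynomial.derivative_sub, Polynomial.derivative_C_mul, mul_sub, ← mul_assoc,
    mul_comm (1 + Polynomial.X) (Polynomial.C 2), mul_assoc, one_add_X_mul_derivative_logTrunc,
    one_add_X_mul_derivative_logTrunc_comp]
  have h2 : (2 : Polynomial ℚ) = Polynomial.C 2 := by rw [Polynomial.C_ofNat]
  rw [h2]; ring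

/-- The right side has no terms below degree `M`. [this work] -/
theorem coeff_rhs_eq_zero (M k : ℕ) (hk : k < M) :
    Polynomial.coeff (Polynomial.C (2 : ℚ) * ((-Polynomial.X) ^ M - (-twoXaddXsq) ^ M)) k = 0 := by
  have hY : (-twoXaddXsq) ^ M = Polynomial.X ^ M * (-(2 + Polynomial.X)) ^ M := by
    rw [← mul_pow, twoXaddXsq]; ring
  rw [Polynomial.coeff_C_mul, Polynomial.coeff_sub, hY, Polynomial.coeff_X_pow_mul', if_neg (not_le.mpr hk),
    neg_pow, show ((-1 : Polynomial ℚ)) ^ M = Polynomial.C ((-1 : ℚ) ^ M) by simp,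
    Polynomial.coeff_C_mul_X_pow, if_neg hk.ne, sub_zero, mul_zero]

/-- If `(1+X)·D` has no terms below degree `M`, neither has `D`. [this work] -/
theorem coeff_eq_zero_of_one_add_X_mul (D : Polynomial ℚ) (M : ℕ)
    (h : ∀ k < M, Polynomial.coeff ((1 + Polynomial.X) * D) k = 0) : ∀ k < M, Polynomial.coeff D k = 0 := by
  intro k
  induction k with
  | zero =>
    intro h0
    have := h 0 h0
    rwa [add_mul, one_mul, Polynomial.coeff_add, Polynomial.coeff_X_mul_zero, add_zero] at this
  | succ k ih =>
    intro hk
    have := h (k + 1) hk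
    rwa [add_mul, one_mul, Polynomial.coeff_add, Polynomial.coeff_X_mul, ih (Nat.lt_of_succ_lt hk),
      add_zero] at this

/-- `coeff 0 (LOG_M) = 0`. [this work] -/
theorem coeff_logTrunc_zero (M : ℕ) : Polynomial.coeff (logTrunc M) 0 = 0 := by
  rw [logTrunc, Polynomial.finsetSum_coeff]
  refine Finset.sum_eq_zero fun j _ => ?_
  rw [Polynomial.coeff_C_mul_X_pow]
  by_cases hj : j = 0
  · subst hj; simp
  · rw [if_neg (fun h => hj h.symm)]

/-- `H_M` has no terms in degrees `0..M`. [this work] -/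
theorem coeff_logCompDiff_eq_zero (M k : ℕ) (hk : k ≤ M) : Polynomial.coeff (logCompDiff M) k = 0 := by
  rcases k with _ | k
  · rw [logCompDiff, Polynomial.coeff_sub, Polynomial.coeff_C_mul, Polynomial.coeff_zero_eq_eval_zero,
      Polynomial.eval_comp, coeff_logTrunc_zero]
    have : twoXaddXsq.eval 0 = 0 := by rw [twoXaddXsq]; simp
    rw [this, ← Polynomial.coeff_zero_eq_eval_zero, coeff_logTrunc_zero]; ring
  · have hder : ∀ j < M, Polynomial.coeff (Polynomial.derivative (logCompDiff M)) j = 0 :=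
      coeff_eq_zero_of_one_add_X_mul _ M fun j hj => by
        rw [one_add_X_mul_derivative_logCompDiff]; exact coeff_rhs_eq_zero M j hj
    have h1 := hder k (Nat.lt_of_succ_le hk)
    rw [Polynomial.coeff_derivative] at h1
    have hk1 : ((k : ℚ) + 1) ≠ 0 := by positivity
    exact (mul_eq_zero.mp h1).resolve_right hk1

/-- `H_M(−2) = −2·LOG_M(−2)` (because `Y(−2) = 0` and `LOG_M(0) = 0`). [this work] -/
theorem eval_neg_two_logCompDiff (M : ℕ) :
    (logCompDiff M).eval (-2) = -2 * (logTrunc M).eval (-2) := by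
  rw [logCompDiff, Polynomial.eval_sub, Polynomial.eval_comp, eval_neg_two_twoXaddXsq,
    ← Polynomial.coeff_zero_eq_eval_zero, coeff_logTrunc_zero, Polynomial.eval_mul, Polynomial.eval_C]
  ring

/-- Nonarchimedean evaluation bound. [folklore] -/
theorem padicNorm_eval_le {p : ℕ} [Fact p.Prime] (Q : Polynomial ℚ) (x t : ℚ) (ht : 0 ≤ t)
    (h : ∀ k, padicNorm p (Q.coeff k * x ^ k) ≤ t) : padicNorm p (Q.eval x) ≤ t := by
  rw [Polynomial.eval_eq_sum_range]
  exact padicNorm.sum_le' (fun k _ => h k) ht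

/-- `|qⁿ|_p = |q|_pⁿ`. [folklore] -/
theorem padicNorm_pow' {p : ℕ} [Fact p.Prime] (q : ℚ) (n : ℕ) : padicNorm p (q ^ n) = padicNorm p q ^ n := by
  induction n with
  | zero => simp
  | succ n ih => rw [pow_succ, padicNorm.mul, ih, pow_succ]

/-- The coefficients `c_j` of `LOG_M` have `|c_j|₂ ≤ 2^{log₂ M}`. [this work] -/
theorem padicNorm_logCoeff_le (M j : ℕ) (hj : j ≤ M) :
    padicNorm 2 (ite (j = 0) (0 : ℚ) ((-1) ^ (j + 1) / (j : ℚ))) ≤ (2 : ℚ) ^ (Nat.log 2 M : ℤ) := by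
  split_ifs with hj0
  · rw [padicNorm.zero]; positivity
  · have hj' : (j : ℚ) ≠ 0 := Nat.cast_ne_zero.mpr hj0
    have h1 : padicNorm 2 ((-1 : ℚ) ^ (j + 1)) = 1 := by
      rw [padicNorm_pow', padicNorm.neg, padicNorm.one, one_pow]
    rw [padicNorm.div, h1, padicNorm.eq_zpow_of_nonzero hj', padicValRat.of_nat, one_div, ← zpow_neg, neg_neg]
    have hv : ((padicValNat 2 j : ℕ) : ℤ) ≤ (Nat.log 2 M : ℤ) := by
      exact_mod_cast (padicValNat_le_nat_log j).trans (Nat.log_mono_right hj)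
    exact zpow_le_zpow_right₀ (by norm_num) hv

/-- `|coeff k (LOG_M)|₂ ≤ 2^{log₂ M}`. [this work] -/
theorem padicNorm_coeff_logTrunc_le (M k : ℕ) :
    padicNorm 2 ((logTrunc M).coeff k) ≤ (2 : ℚ) ^ (Nat.log 2 M : ℤ) := by
  rw [logTrunc, Polynomial.finsetSum_coeff]
  refine padicNorm.sum_le' (fun j hj => ?_) (by positivity)
  rw [Polynomial.coeff_C_mul_X_pow]
  by_cases hkj : k = j
  · rw [if_pos hkj]
    exact padicNorm_logCoeff_le M j (Nat.lt_succ_iff.mp (Finset.mem_range.mp hj))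
  · rw [if_neg hkj, padicNorm.zero]; positivity

/-- `Y^j` has integer coefficients. [this work] -/
theorem padicNorm_coeff_twoXaddXsq_pow_le (j k : ℕ) : padicNorm 2 ((twoXaddXsq ^ j).coeff k) ≤ 1 := by
  have hY : twoXaddXsq = Polynomial.map (Int.castRingHom ℚ) (2 * Polynomial.X + Polynomial.X ^ 2) := by
    rw [twoXaddXsq]; simp
  rw [hY, ← Polynomial.map_pow, Polynomial.coeff_map, eq_intCast]
  exact padicNorm.of_int _

/-- `|coeff k (LOG_M ∘ Y)|₂ ≤ 2^{log₂ M}`. [this work] -/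
theorem padicNorm_coeff_logTrunc_comp_le (M k : ℕ) :
    padicNorm 2 (((logTrunc M).comp twoXaddXsq).coeff k) ≤ (2 : ℚ) ^ (Nat.log 2 M : ℤ) := by
  have hc : (logTrunc M).comp twoXaddXsq = ∑ j ∈ Finset.range (M + 1),
      Polynomial.C (ite (j = 0) (0 : ℚ) ((-1) ^ (j + 1) / (j : ℚ))) * twoXaddXsq ^ j := by
    rw [logTrunc, ← Polynomial.coe_compRingHom_apply, map_sum]
    refine Finset.sum_congr rfl fun j _ => ?_
    rw [Polynomial.coe_compRingHom_apply, Polynomial.mul_comp, Polynomial.C_comp, Polynomial.X_pow_comp]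
  rw [hc, Polynomial.finsetSum_coeff]
  refine padicNorm.sum_le' (fun j hj => ?_) (by positivity)
  rw [Polynomial.coeff_C_mul, padicNorm.mul]
  calc padicNorm 2 (ite (j = 0) (0 : ℚ) ((-1) ^ (j + 1) / (j : ℚ))) * padicNorm 2 ((twoXaddXsq ^ j).coeff k)
      ≤ (2 : ℚ) ^ (Nat.log 2 M : ℤ) * 1 :=
        mul_le_mul (padicNorm_logCoeff_le M j (Nat.lt_succ_iff.mp (Finset.mem_range.mp hj)))
          (padicNorm_coeff_twoXaddXsq_pow_le j k) (padicNorm.nonneg _) (by positivity)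
    _ = (2 : ℚ) ^ (Nat.log 2 M : ℤ) := mul_one _

/-- `|coeff k (H_M)|₂ ≤ 2^{log₂ M}`. [this work] -/
theorem padicNorm_coeff_logCompDiff_le (M k : ℕ) :
    padicNorm 2 ((logCompDiff M).coeff k) ≤ (2 : ℚ) ^ (Nat.log 2 M : ℤ) := by
  rw [logCompDiff, Polynomial.coeff_sub, Polynomial.coeff_C_mul]
  refine padicNorm.sub.trans (max_le (padicNorm_coeff_logTrunc_comp_le M k) ?_)
  rw [padicNorm.mul]
  have h2 : padicNorm 2 (2 : ℚ) ≤ 1 := by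
    have := padicNorm.padicNorm_p_of_prime (p := 2); push_cast at this; rw [this]; norm_num
  calc padicNorm 2 2 * padicNorm 2 ((logTrunc M).coeff k) ≤ 1 * (2 : ℚ) ^ (Nat.log 2 M : ℤ) :=
        mul_le_mul h2 (padicNorm_coeff_logTrunc_le M k) (padicNorm.nonneg _) (by norm_num)
    _ = (2 : ℚ) ^ (Nat.log 2 M : ℤ) := one_mul _

/-- THE FINITE FORM OF `log₂(−1) = 0`: `|LOG_M(−2)|₂ ≤ 2^{log₂ M − M}` for every `M`. [this work] -/
theorem padicNorm_logTrunc_neg_two_le (M : ℕ) :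
    padicNorm 2 ((logTrunc M).eval (-2)) ≤ (2 : ℚ) ^ ((Nat.log 2 M : ℤ) - M) := by
  have hhalf : padicNorm 2 (-2 : ℚ) = 2⁻¹ := by
    rw [padicNorm.neg]; have := padicNorm.padicNorm_p_of_prime (p := 2); push_cast at this; exact this
  have hH : padicNorm 2 ((logCompDiff M).eval (-2)) ≤ (2 : ℚ) ^ (Nat.log 2 M : ℤ) * 2⁻¹ ^ (M + 1) := by
    refine padicNorm_eval_le _ _ _ (by positivity) fun k => ?_
    by_cases hk : k ≤ M
    · rw [coeff_logCompDiff_eq_zero M k hk, zero_mul, padicNorm.zero]; positivity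
    · rw [padicNorm.mul, padicNorm_pow', hhalf]
      exact mul_le_mul (padicNorm_coeff_logCompDiff_le M k)
        (pow_le_pow_of_le_one (by norm_num) (by norm_num) (by omega)) (by positivity) (by positivity)
  have h2 : padicNorm 2 (2 : ℚ) = 2⁻¹ := by
    have := padicNorm.padicNorm_p_of_prime (p := 2); push_cast at this; exact this
  have hev : (logTrunc M).eval (-2) = ((-1) / 2 : ℚ) * (logCompDiff M).eval (-2) := by
    rw [eval_neg_two_logCompDiff]; ring
  have hn : padicNorm 2 ((-1) / 2 : ℚ) = 2 := by
    rw [padicNorm.div, padicNorm.neg, padicNorm.one, h2]; norm_num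
  rw [hev, padicNorm.mul, hn]
  calc (2 : ℚ) * padicNorm 2 ((logCompDiff M).eval (-2))
      ≤ 2 * ((2 : ℚ) ^ (Nat.log 2 M : ℤ) * 2⁻¹ ^ (M + 1)) := by gcongr
    _ = (2 : ℚ) ^ ((Nat.log 2 M : ℤ) - M) := by
        rw [zpow_sub₀ (two_ne_zero), zpow_natCast, zpow_natCast, inv_pow, pow_succ]; field_simp

end Summit.Schanuel.Schanuel.Theorems
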